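import Summits.HodgeConjecture.HodgeConjecture.Theses.QbarEnvelope
import Summits.HodgeConjecture.HodgeConjecture.Theses.LinearSystemTorelli
import Summits.HodgeConjecture.HodgeConjecture.Theorems.LinearSystemTorelliMiddleDivisorSupportFourfoldStubDominantEnvelope
import Summits.HodgeConjecture.HodgeConjecture.Theorems.LinearSystemTorelliMiddleDivisorSupportFourfoldStubFiniteMonodromyOfTypeStability
import Summits.HodgeConjecture.HodgeConjecture.Theorems.PeriodDeficiencyQbarGenericIsHodgeGenericStubFiberOverConjPointIso
import Summits.HodgeConjecture.HodgeConjecture.Theorems.QbarEnvelopeEnvelopeStubNumberFieldModel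
import Literature.AlgebraicGeometry.HodgeTheory.AlgebraicCyclesDefinedOverQbarSpread
import Literature.AlgebraicGeometry.HodgeTheory.HodgeConjectureQbarVoisin
import Literature.AlgebraicGeometry.HodgeTheory.QbarFamilyLocalSystem
import Literature.AlgebraicGeometry.HodgeTheory.HodgeTypeConjugation
import Literature.AlgebraicGeometry.HodgeTheory.HodgeGenericQbarDescentProofs
import Literature.AlgebraicGeometry.Motives.ComplexPointsManifold
import Literature.AlgebraicGeometry.FundamentalGroup.RiemannExistenceQbarDescentProofs
import Literature.AlgebraicGeometry.FundamentalGroup.RiemannExistenceSmoothAffine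
import Literature.AlgebraicGeometry.FundamentalGroup.RiemannExistenceSeparatingLowDim
import Literature.NumberTheory.Transcendental.AnalytificationSeparatedProofs
import Mathlib.Topology.Baire.Lemmas
import Mathlib.Topology.Baire.LocallyCompactRegular
import Mathlib.Topology.GDelta.Basic

/-!
# Line `hodge-rank-conjugation` — an ALTERNATIVE skeleton of the crux `Envelope` (stmt-HodgeConjecture-1069)

Crux-strategist line (planner-cstrat-stmt-HodgeConjecture-1069-s2-0, 2026-08-17), registered NEXT TO
the live skeleton `Lines/birth.lean` (never over it). Same crux, concluded BY NAME:

  `Envelope := ∀ n X, IsSmoothProjective n X → ∀ p (c : complexBetti X (2*p)), IsRationalClass c →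
     IsOfHodgeType n X (2*p) p p c → ∃ m W (ι : X ⟶ W) c', IsSmoothProjective m W ∧
     (∃ K [NumberField K] (σ : K →+* ℂ) W₀, Nonempty (W ≅ W₀ ⊗_{K,σ} ℂ)) ∧ IsRationalClass c' ∧
     IsOfHodgeType m W (2*p) p p c' ∧ ι^* c' = c`.

## The idea (lens: TRANSFER from the sibling crux stmt-11595, + a Baire shortcut)

`birth` cuts Voisin's `ℚ̄`-funnel at its transcendence kernel T = "type stability of a rational
`(p,p)` class along loops at a `ℚ̄`-generic point of a `ℚ̄`-family" (a MONODROMY statement IN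
FAMILIES; nineteen lead cycles on the sister crux stmt-2409 found no handle on it and no cheaper
known case the composition accepts). This line replaces T by a FAMILY-FREE, NUMERICAL kernel:

* **K (`stub_hodgeRank_conjugateVariety`, OPEN)** — the HODGE RANK
  `ρᵖ(X) := dim_ℚ span_ℚ {rational (p,p) classes in H²ᵖ(X(ℂ); ℂ)}` of a smooth projective complex
  variety is invariant under conjugation of the variety by automorphisms of `ℂ` over `ℚ̄`:
  `ρᵖ(Y) = ρᵖ(X)` whenever `Y ≅ X^τ`, `τ ∈ Aut(ℂ/σℚ̄)`. It is the numerical shadow of Deligne's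
  "Hodge classes are absolute Hodge" (Charles–Schnell Conj. 11.2.17: `(τ⁻¹)^*` should carry Hodge
  classes of `X` to Hodge classes of `X^τ` — a fortiori the dimensions agree) and is implied by HC
  (homological equivalence of algebraic cycles is `Aut(ℂ)`-invariant through ALGEBRAIC de Rham
  cohomology, so `dim_ℚ Algᵖ(X^τ) = dim_ℚ Algᵖ(X)`). KNOWN SECTORS: `p = 1` for every `X`
  (Lefschetz (1,1): `ρ¹` = Picard number, and `NS(X) ≅ NS(X^τ)` since `X ≅ X^τ` as abstract
  schemes); abelian varieties and abelian-type motives (Deligne 1982: Hodge ⇒ absolute Hodge);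
  every `(X, p)` where HC is known for `X` and `X^τ`; `X` definable over `ℚ̄` (then `X^τ ≅ X` over `ℂ`).
  This is the sibling crux's family-free core `stub_mtRank_hodge_conjugateVariety`
  (`Cruxes/QbarGenericIsHodgeGeneric/Lines/birth.lean`, r4: Mumford–Tate rank of `Hⁱ(X^τ)` = that of
  `Hⁱ(X)`) with the Mumford–Tate rank REPLACED BY THE HODGE RANK — what we lack there (`BettiHodgeData`,
  `GeometricVHSData`, Mumford–Tate groups, the CDK countability fact, special closures,
  countable-orbit descent) is simply not needed here.
* **J1 (`stub_typeStability_of_hodgeRank_eq_generic`, classical)** — Deligne's "very general point"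
  lemma FOR CLASSES with its numerical characterisation: on the complexification of a `ℚ̄`-family
  there is a generic rank `g` such that the JUMP LOCUS `{t : ρᵖ(𝒳_t) ≠ g}` is MEAGRE in `S(ℂ)` and at
  every point of rank `g` every rational `(p,p)` class is type-stable along ALL loops (Deligne 1972
  Prop. 7.5; CDK 1995 §1; Voisin II §5.3.1 — holomorphy of `Fᵖ`, identity principle on the leaves of
  the étalé space `FiberClass`, Baire; the tensor analogue's Baire half is PROVED in the tree,
  `HodgeGenericPointOfLociDichotomy.exists_generic_of_lociDichotomy`).
* **J2 (`stub_isMeagre_compl_orbit_of_qbarGeneric`, classical)** — the `Aut(ℂ/ℚ̄)`-orbit of a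
  `ℚ̄`-generic point of `S₀ ⊗_σ ℂ` is COMEAGRE: `Aut(ℂ/ℚ̄)` is transitive on the complex points over
  the generic point of `S₀` (extension of isomorphisms of countable subfields to automorphisms of
  `ℂ`, Lang III §4 / `IsAlgClosure.equivOfEquiv`), and the other points lie on the countably many
  proper closed `ℚ̄`-subvarieties, each nowhere dense in the analytic topology.
* **D (`stub_deligneGlobalInvariantCycles`)** — Deligne's partie fixe, the EXISTING item stmt-16363
  BY NAME (shared verbatim with `birth`).

Composition (`Envelope_of`, kernel-checked, no `sorry`): spread `X` out over `ℚ̄` (PROVED): `X ≅ 𝒳_s`,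
`s` `ℚ̄`-generic; `S(ℂ)` is a Baire space (topological manifold), so off the union of the two meagre
sets (J1, J2) there is a conjugate `τ · s` of generic Hodge rank; `𝒳_{τ·s} ≅ (𝒳_s)^τ` (LANDED,
`Theorems.stub_fiberOver_conjPoint_iso`, p155949), so by K the Hodge rank of `𝒳_s` is generic too and
J1 gives type stability of `(e⁻¹)^* c` along all loops at `s`; hence finite monodromy
(`Theorems.linearSystemTorelli_finite_setOf_isContinuationAlong_of_forall_isOfHodgeType`, PROVED);
Voisin's mechanism B (`Theorems.stub_dominantEnvelopeOfFiniteMonodromy`, PROVED) fed with Riemann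
existence — **DISCHARGED in the tree since 2026-08-17T09:2xZ**
(`FundamentalGroup.riemannExistence_qbarDescent_of_finiteIndex_holds`; so the live line's stub C is now
a one-liner, recorded sorry-free below as `locallyAlgebraicSeparatingSmoothAffineDimGeTwo_holds`) — and
D gives the dominant `ℚ̄`-envelope; `isSmoothProjective_of_baseChangeHom` (PROVED) + the number-field
model N (`Theorems.stub_numberFieldModel`, LANDED p145483) + transitivity of base change finish.

`sorry` occurs only inside the four `stub_*` theorems. Probes (folder `bc/`, `BC3`-protocol): for
S ∈ {K, J1, J2} and T ∈ {crux, `HodgeConjecture`}, `exact?` / `simpa using h` / `simpa [T] using h` /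
`(unfold T; simpa using h)` / `aesop` — 30/30 FAIL. Why the line dodges the STUCK goal of `birth`: T has
no family-free form and no known case the composition accepts; K is a statement about ONE variety and
its conjugate, with the `p = 1` sector a theorem (Lefschetz (1,1) + scheme-invariance of `NS`), the
abelian-type sector a theorem (Deligne 1982), every HC-known sector a theorem, and a one-sided
reformulation (`ρᵖ` cannot DROP under conjugation) — and J1/J2 are closable classical lemmas whose
tensor analogues the tree already half-proves. Tightness (paper, not needed by the skeleton): T for
all `(n,p)` ⟹ K (spread `X`; `X^τ ≅ 𝒳_{τ·s}` is again a `ℚ̄`-generic fibre; rank is generic at both),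
so K relocates the kernel, it does not strengthen it.

Disproof used: none relevant (no `Cruxes/Envelope/Disproof.lean`, no `Negative/`; negatives index of the
summit: MilnorK symbol lift, Fermat-K3 multisets, E-line matrices — none touches a stub).
-/

set_option linter.dupNamespace false

namespace Summit.HodgeConjecture.HodgeConjecture.Cruxes.Envelope.HodgeRankConjugation

open CategoryTheory AlgebraicGeometry Topology
open Literature.AlgebraicGeometry Literature.AlgebraicGeometry.Motives
open Literature.AlgebraicGeometry.HodgeTheory
open Literature.AlgebraicTopology.SingularHomology

/-! ### The registered stubs -/

/-- **K — THE HODGE RANK IS AN `Aut(ℂ/ℚ̄)`-CONJUGATION INVARIANT (the kernel; OPEN, family-free).**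
For `σ : ℚ̄ →+* ℂ`, `τ ∈ Aut(ℂ/σℚ̄)`, a smooth projective complex `X` of dimension `n` and any
`ℂ`-scheme `Y ≅ X^τ` (`Motives.conjugateVariety`, Deligne's convention), the `ℚ`-dimension of the
`ℚ`-span of the rational `(p,p)` classes in `H²ᵖ(Y(ℂ); ℂ)` equals that of `X`, for every `p`.
(For `X` smooth projective the rational `(p,p)` classes already form a `ℚ`-subspace —
`IsRationalClass.add/.smul`, `IsOfHodgeType.add/.smul`, model independence discharged — of finite
dimension `≤ b₂ₚ`; stating `Y ≅ X^τ` rather than `Y = X^τ` folds in the trivial isomorphism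
invariance.) Why plausibly true: implied by HC (algebraic de Rham cohomology makes homological
equivalence `Aut(ℂ)`-invariant) and by Deligne's absoluteness conjecture (Charles–Schnell Conj.
11.2.17 ⇒ `(τ⁻¹)^*` is a bijection on Hodge classes); TRUE for `p = 1` (Picard number), for abelian
varieties / abelian-type motives (Deligne 1982), for `X` over `ℚ̄`. Why it might fail: a pair
`(X, τ)` with `ρᵖ(X^τ) < ρᵖ(X)` — a Hodge class of "Galois type" that is not absolute Hodge; it would
refute HC (Voisin 2007 §0). Equivalent on paper to `birth`'s kernel T for all `(n,p)` modulo J1, J2,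
spreading out and the fibre isomorphism. [cite: CharlesSchnell2014Notes, Conj. 11.2.17, §11.2.2
(cattani2014 p. 474) and Thm. 11.3.17] [cite: Deligne1982HodgeCycles, Thm. 2.11]
[cite: Voisin2007HodgeLoci, Thm. 0.5, Cor. 0.6] -/
theorem stub_hodgeRank_conjugateVariety :
    ∀ (σ : AlgebraicClosure ℚ →+* ℂ) (τ : ringAutOver σ) ⦃n : ℕ⦄ ⦃X Y : SchemeOver ℂ⦄,
      IsSmoothProjective n X →
      Nonempty (Y ≅ conjugateVariety
        (@AlgEquiv.toRingEquiv (AlgebraicClosure ℚ) ℂ ℂ _ _ _ σ.toAlgebra σ.toAlgebra τ) X) →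
      ∀ p : ℕ,
        Module.finrank ℚ ↥(Submodule.span ℚ {c : RestrictScalars ℚ ℂ (complexBetti Y (2 * p)) |
            IsRationalClass (show complexBetti Y (2 * p) from c) ∧
              IsOfHodgeType n Y (2 * p) p p (show complexBetti Y (2 * p) from c)}) =
        Module.finrank ℚ ↥(Submodule.span ℚ {c : RestrictScalars ℚ ℂ (complexBetti X (2 * p)) |
            IsRationalClass (show complexBetti X (2 * p) from c) ∧
              IsOfHodgeType n X (2 * p) p p (show complexBetti X (2 * p) from c)}) := by
  sorry

/-- **J1 — TYPE STABILITY AT POINTS OF GENERIC HODGE RANK, AND THE JUMP LOCUS IS MEAGRE (Deligne's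
"very general point" lemma for classes, numerical form; classical, unformalised).** For the
complexification `f = f₀ ⊗_σ ℂ` of a `ℚ̄`-morphism of quasi-projective `ℚ̄`-schemes with smooth
irreducible base, smooth projective of relative dimension `n`, and a degree `2p`: there is `g : ℕ`
(the rank of the sub-local-system `G ⊆ R²ᵖ f_* ℚ` of classes whose whole flat leaf consists of Hodge
classes) such that (a) `{t ∈ S(ℂ) : ρᵖ(𝒳_t) ≠ g}` is meagre — it is the union, over the countably many
leaves `Λ` of the étalé space not contained in the locus of Hodge classes, of the projections of the
PROPER closed analytic subsets `Λ ∩ HL` (holomorphy of `Fᵖ`; identity principle on the connected `Λ`;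
`π|_Λ` a local homeomorphism; second countability), and (b) at a point `t` with `ρᵖ(𝒳_t) = g` one has
`Hdg(𝒳_t) = G_t`, so every rational `(p,p)` class at `t` has all its loop-continuations of type
`(p,p)`. Why plausibly true: Deligne 1972 Prop. 7.5 / CDK 1995 §1 / Voisin II §5.3.1 (for classes
instead of tensors; the tree PROVES the Baire half of the tensor version,
`exists_generic_of_lociDichotomy`, and has the carriers `FiberClass`, `transportFun`,
`IsContinuationAlong`). Size L (the analytic input = the local dichotomy "locus of a flat class being
`(p,p)` is all of a small ball or nowhere dense"). [cite: Deligne1972WeilK3, Prop. 7.5]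
[cite: CattaniDeligneKaplan1995JAMS, §1] [cite: VoisinHodgeII2003, §5.3.1] [cite: Klingler2022HodgeICM, §2.6] -/
theorem stub_typeStability_of_hodgeRank_eq_generic :
    ∀ (σ : AlgebraicClosure ℚ →+* ℂ) ⦃𝒳₀ S₀ : SchemeOver (AlgebraicClosure ℚ)⦄ (f₀ : 𝒳₀ ⟶ S₀)
      (n p : ℕ), IsQuasiProjectiveOver 𝒳₀ → IsQuasiProjectiveOver S₀ → IrreducibleSpace S₀.left →
      AlgebraicGeometry.Smooth S₀.hom → IsSmoothProjectiveFamily ((baseChangeHom σ).map f₀) n →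
      ∃ g : ℕ,
        IsMeagre {t : ComplexPoints ((baseChangeHom σ).obj S₀) |
          Module.finrank ℚ ↥(Submodule.span ℚ {c : RestrictScalars ℚ ℂ
              (complexBetti (fiberOver ((baseChangeHom σ).map f₀) t) (2 * p)) |
            IsRationalClass (show complexBetti (fiberOver ((baseChangeHom σ).map f₀) t) (2 * p) from c) ∧
              IsOfHodgeType n (fiberOver ((baseChangeHom σ).map f₀) t) (2 * p) p p
                (show complexBetti (fiberOver ((baseChangeHom σ).map f₀) t) (2 * p) from c)}) ≠ g} ∧
        ∀ (t : ComplexPoints ((baseChangeHom σ).obj S₀)),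
          Module.finrank ℚ ↥(Submodule.span ℚ {c : RestrictScalars ℚ ℂ
              (complexBetti (fiberOver ((baseChangeHom σ).map f₀) t) (2 * p)) |
            IsRationalClass (show complexBetti (fiberOver ((baseChangeHom σ).map f₀) t) (2 * p) from c) ∧
              IsOfHodgeType n (fiberOver ((baseChangeHom σ).map f₀) t) (2 * p) p p
                (show complexBetti (fiberOver ((baseChangeHom σ).map f₀) t) (2 * p) from c)}) = g →
          ∀ (α : complexBetti (fiberOver ((baseChangeHom σ).map f₀) t) (2 * p)),
            IsRationalClass α → IsOfHodgeType n (fiberOver ((baseChangeHom σ).map f₀) t) (2 * p) p p α →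
            ∀ (γ : Path t t) (β : complexBetti (fiberOver ((baseChangeHom σ).map f₀) t) (2 * p)),
              IsContinuationAlong γ α β →
                IsOfHodgeType n (fiberOver ((baseChangeHom σ).map f₀) t) (2 * p) p p β := by
  sorry

/-- **J2 — THE `Aut(ℂ/ℚ̄)`-ORBIT OF A `ℚ̄`-GENERIC POINT IS COMEAGRE (classical, unformalised).** For
`S₀` smooth irreducible quasi-projective over `ℚ̄` and `s ∈ S(ℂ)`, `S = S₀ ⊗_σ ℂ`, lying over the
generic point of `S₀`: the complement of `{τ · s : τ ∈ Aut(ℂ/σℚ̄)}` (`conjPoint`) is meagre in `S(ℂ)`.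
Proof on paper: (i) the orbit is EXACTLY the set of points over the generic point — two complex points
over `η` are two `ℚ̄`-embeddings of `κ(η)` into `ℂ`, conjugate under `Aut(ℂ/ℚ̄)` (isomorphic countable
subfields of `ℂ` have transcendence bases of `ℂ` over them of equal cardinality; extend through
`IsAlgClosure.equivOfEquiv`; Lang III §4, Charles–Schnell proof of Thm. 11.2.8: "any two embeddings
of k into ℂ are conjugated by an automorphism of ℂ"); (ii) the points NOT over `η` lie over the
countably many non-generic points of the finite-type `ℚ̄`-scheme `S₀`, i.e. on countably many sets
`Y₀(ℂ)`, `Y₀ ⊊ S₀` closed, each a proper Zariski-closed subset of the irreducible `S(ℂ)` and hence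
closed nowhere dense in the analytic topology. Size M–L; reusable by the sibling line (it upgrades
the tree's Zariski density `exists_complexPoint_base_pt_eq_mem_of_closure_eq_univ`).
[cite: Lang1958IAG, Ch. III §4 Thm. 9 and §5] [cite: CharlesSchnell2014Notes, proof of Thm. 11.2.8
(cattani2014 p. 466) and Lemma 11.3.14] -/
theorem stub_isMeagre_compl_orbit_of_qbarGeneric :
    ∀ (σ : AlgebraicClosure ℚ →+* ℂ) (S₀ : SchemeOver (AlgebraicClosure ℚ)),
      IsQuasiProjectiveOver S₀ → IrreducibleSpace S₀.left → AlgebraicGeometry.Smooth S₀.hom →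
      ∀ (s : ComplexPoints ((baseChangeHom σ).obj S₀)),
        closure {(baseChangeHomFst σ S₀).base s.pt} = (Set.univ : Set S₀.left) →
        IsMeagre (Set.range fun τ : ringAutOver σ ↦ conjPoint σ S₀ τ s)ᶜ := by
  sorry

/-- **D — Deligne's global invariant cycle theorem (théorème de la partie fixe), as the EXISTING route
item stmt-HodgeConjecture-16363 BY NAME** (verbatim the live line's stub; `Iff.rfl` with the named
fact `deligne_globalInvariantCycles`; closes by
`exact Theses.LinearSystemTorelli.DeligneGlobalInvariantCycles_holds` the moment that item closes).
[cite: DeligneHodgeII1971, Thm. 4.1.1] [cite: VoisinHodgeII2003, Prop. 4.23, Thm. 4.24] -/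
theorem stub_deligneGlobalInvariantCycles :
    Summit.HodgeConjecture.HodgeConjecture.Theses.LinearSystemTorelli.DeligneGlobalInvariantCycles := by
  sorry

/-! ### Sorry-free links -/

/-- **K → J1 → J2 ⟹ type stability at `ℚ̄`-generic points along ALL loops** (the `A'`-form of the
live line's kernel, with `Z₀ = ∅`), kernel-checked: Baire on the topological manifold `S(ℂ)`
(`ComplexPoints.chartedSpace`, Hausdorff + locally compact), the landed fibre isomorphism
`Theorems.stub_fiberOver_conjPoint_iso` (p155949) and K transport the generic rank to `s`. [folklore] -/
theorem typeStabilityAtQbarGeneric_of_hodgeRank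
    (hK : ∀ (σ : AlgebraicClosure ℚ →+* ℂ) (τ : ringAutOver σ) ⦃n : ℕ⦄ ⦃X Y : SchemeOver ℂ⦄,
      IsSmoothProjective n X →
      Nonempty (Y ≅ conjugateVariety
        (@AlgEquiv.toRingEquiv (AlgebraicClosure ℚ) ℂ ℂ _ _ _ σ.toAlgebra σ.toAlgebra τ) X) →
      ∀ p : ℕ,
        Module.finrank ℚ ↥(Submodule.span ℚ {c : RestrictScalars ℚ ℂ (complexBetti Y (2 * p)) |
            IsRationalClass (show complexBetti Y (2 * p) from c) ∧
              IsOfHodgeType n Y (2 * p) p p (show complexBetti Y (2 * p) from c)}) =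
        Module.finrank ℚ ↥(Submodule.span ℚ {c : RestrictScalars ℚ ℂ (complexBetti X (2 * p)) |
            IsRationalClass (show complexBetti X (2 * p) from c) ∧
              IsOfHodgeType n X (2 * p) p p (show complexBetti X (2 * p) from c)}))
    (hJ1 : ∀ (σ : AlgebraicClosure ℚ →+* ℂ) ⦃𝒳₀ S₀ : SchemeOver (AlgebraicClosure ℚ)⦄ (f₀ : 𝒳₀ ⟶ S₀)
      (n p : ℕ), IsQuasiProjectiveOver 𝒳₀ → IsQuasiProjectiveOver S₀ → IrreducibleSpace S₀.left →
      AlgebraicGeometry.Smooth S₀.hom → IsSmoothProjectiveFamily ((baseChangeHom σ).map f₀) n →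
      ∃ g : ℕ,
        IsMeagre {t : ComplexPoints ((baseChangeHom σ).obj S₀) |
          Module.finrank ℚ ↥(Submodule.span ℚ {c : RestrictScalars ℚ ℂ
              (complexBetti (fiberOver ((baseChangeHom σ).map f₀) t) (2 * p)) |
            IsRationalClass (show complexBetti (fiberOver ((baseChangeHom σ).map f₀) t) (2 * p) from c) ∧
              IsOfHodgeType n (fiberOver ((baseChangeHom σ).map f₀) t) (2 * p) p p
                (show complexBetti (fiberOver ((baseChangeHom σ).map f₀) t) (2 * p) from c)}) ≠ g} ∧
        ∀ (t : ComplexPoints ((baseChangeHom σ).obj S₀)),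
          Module.finrank ℚ ↥(Submodule.span ℚ {c : RestrictScalars ℚ ℂ
              (complexBetti (fiberOver ((baseChangeHom σ).map f₀) t) (2 * p)) |
            IsRationalClass (show complexBetti (fiberOver ((baseChangeHom σ).map f₀) t) (2 * p) from c) ∧
              IsOfHodgeType n (fiberOver ((baseChangeHom σ).map f₀) t) (2 * p) p p
                (show complexBetti (fiberOver ((baseChangeHom σ).map f₀) t) (2 * p) from c)}) = g →
          ∀ (α : complexBetti (fiberOver ((baseChangeHom σ).map f₀) t) (2 * p)),
            IsRationalClass α → IsOfHodgeType n (fiberOver ((baseChangeHom σ).map f₀) t) (2 * p) p p α →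
            ∀ (γ : Path t t) (β : complexBetti (fiberOver ((baseChangeHom σ).map f₀) t) (2 * p)),
              IsContinuationAlong γ α β →
                IsOfHodgeType n (fiberOver ((baseChangeHom σ).map f₀) t) (2 * p) p p β)
    (hJ2 : ∀ (σ : AlgebraicClosure ℚ →+* ℂ) (S₀ : SchemeOver (AlgebraicClosure ℚ)),
      IsQuasiProjectiveOver S₀ → IrreducibleSpace S₀.left → AlgebraicGeometry.Smooth S₀.hom →
      ∀ (s : ComplexPoints ((baseChangeHom σ).obj S₀)),
        closure {(baseChangeHomFst σ S₀).base s.pt} = (Set.univ : Set S₀.left) →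
        IsMeagre (Set.range fun τ : ringAutOver σ ↦ conjPoint σ S₀ τ s)ᶜ) :
    ∀ (σ : AlgebraicClosure ℚ →+* ℂ) ⦃𝒳₀ S₀ : SchemeOver (AlgebraicClosure ℚ)⦄ (f₀ : 𝒳₀ ⟶ S₀)
      (n p : ℕ), IsQuasiProjectiveOver 𝒳₀ → IsQuasiProjectiveOver S₀ → IrreducibleSpace S₀.left →
      AlgebraicGeometry.Smooth S₀.hom → IsSmoothProjectiveFamily ((baseChangeHom σ).map f₀) n →
      ∀ (s : ComplexPoints ((baseChangeHom σ).obj S₀)),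
        closure {(baseChangeHomFst σ S₀).base s.pt} = (Set.univ : Set S₀.left) →
        ∀ (α : complexBetti (fiberOver ((baseChangeHom σ).map f₀) s) (2 * p)),
          IsRationalClass α → IsOfHodgeType n (fiberOver ((baseChangeHom σ).map f₀) s) (2 * p) p p α →
          ∀ (γ : Path s s) (β : complexBetti (fiberOver ((baseChangeHom σ).map f₀) s) (2 * p)),
            IsContinuationAlong γ α β →
              IsOfHodgeType n (fiberOver ((baseChangeHom σ).map f₀) s) (2 * p) p p β := by
  intro σ 𝒳₀ S₀ f₀ n p h𝒳₀ hS₀ hirr hsm hf s hgen α hα hh γ β hγ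
  obtain ⟨g, hM, hstab⟩ := hJ1 σ f₀ n p h𝒳₀ hS₀ hirr hsm hf
  -- `S(ℂ)` is a Baire space (a topological manifold: Hausdorff and locally compact)
  haveI := hirr
  haveI := hsm
  obtain ⟨d, hd⟩ := exists_smoothOfRelativeDimension_baseChangeHom σ S₀
  haveI := hd
  have hS : IsQuasiProjectiveOver ((baseChangeHom σ).obj S₀) := hS₀.baseChangeHom σ
  haveI : LocallyOfFiniteType ((baseChangeHom σ).obj S₀).hom := hS.locallyOfFiniteType
  haveI : IsSeparated ((baseChangeHom σ).obj S₀).hom := hS.isVarietyPair_ofScheme.isSeparated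
  haveI : T2Space (ComplexPoints ((baseChangeHom σ).obj S₀)) :=
    Literature.NumberTheory.Transcendental.t2Space_algPoints_holds _ ℂ
  letI := Motives.ComplexPoints.chartedSpace ((baseChangeHom σ).obj S₀) d
  haveI : LocallyCompactSpace (ComplexPoints ((baseChangeHom σ).obj S₀)) :=
    ChartedSpace.locallyCompactSpace (EuclideanSpace ℝ (Fin (2 * d))) _
  haveI : Nonempty (ComplexPoints ((baseChangeHom σ).obj S₀)) := ⟨s⟩
  -- off the union of the two meagre sets: a point of generic Hodge rank in the orbit of `s`
  have hdense := dense_of_mem_residual ((hM.union (hJ2 σ S₀ hS₀ hirr hsm s hgen)))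
  obtain ⟨t₁, ht₁⟩ := hdense.nonempty
  simp only [Set.compl_union, compl_compl, Set.mem_inter_iff, Set.mem_compl_iff, Set.mem_setOf_eq,
    not_not, Set.mem_range] at ht₁
  obtain ⟨hρ, τ, rfl⟩ := ht₁
  -- the fibre over `τ · s` is the `τ`-conjugate of the fibre over `s` (landed, p155949), so K applies
  obtain ⟨e⟩ := Theorems.stub_fiberOver_conjPoint_iso σ f₀ τ s
  have hK' := hK σ τ (hf.isSmoothProjective s) ⟨e⟩ p
  exact hstab s (hK'.symm.trans hρ) α hα hh γ β hγ

/-- **The live line's stub C is now a THEOREM of the tree** (news for `birth`, recorded here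
sorry-free): locally algebraic separating functions on finite coverings of smooth irreducible affine
`ℂ`-schemes of relative dimension `≥ 2` — VERBATIM the registered signature of
`Birth.stub_locallyAlgebraicSeparatingSmoothAffineDimGeTwo` — from the tree's discharge of Riemann's
existence theorem `FundamentalGroup.SmoothAffine.exists_locallyAlgebraicSeparating`
(`RiemannExistenceSmoothAffine.lean`, landed 2026-08-17T09:2xZ, AFTER the birth skeleton: Hörmander
`L²` on the Riemann domain in étale coordinates). A prover can land this one-liner
`--supports stmt-HodgeConjecture-1069` (and the sister crux stmt-2409's identical stub) today.
[cite: SGA1, Exp. XII Thm. 5.1 (p. 333), proof, part 2] -/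
theorem locallyAlgebraicSeparatingSmoothAffineDimGeTwo_holds :
    ∀ (n : ℕ) (S : SchemeOver ℂ), IsAffine S.left → SmoothOfRelativeDimension (n + 2) S.hom →
      IrreducibleSpace S.left →
      ∀ (T : Type) [TopologicalSpace T] (q : T → ComplexPoints S) (_ : IsCoveringMap q)
        (_ : ∀ t, (q ⁻¹' {t}).Finite) (P₀ : ComplexPoints S),
        ∃ (U : S.left.Opens) (_ : IsAffineOpen U) (_ : P₀.pt ∈ U) (h : T → ℂ)
          (F : Polynomial Γ(S.left, U)),
          ContinuousOn h (q ⁻¹' {P | P.pt ∈ U}) ∧ F ≠ 0 ∧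
          (∀ (t : T) (ht : (q t).pt ∈ U), (F.map ((q t).evalRingHom U ht)).eval (h t) = 0) ∧
          Set.InjOn h (q ⁻¹' {P₀}) := by
  intro n S hS hn hirr T _ q hq hfin P₀
  haveI := hS
  haveI := hirr
  haveI := hn
  haveI : AlgebraicGeometry.Smooth S.hom := AlgebraicGeometry.SmoothOfRelativeDimension.smooth (n := n + 2) S.hom
  exact Literature.AlgebraicGeometry.FundamentalGroup.SmoothAffine.exists_locallyAlgebraicSeparating S T q
    hq hfin P₀

/-- **Riemann existence with `ℚ̄`-descent, finite-index form** (the antecedent C of Voisin's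
mechanism B) is DISCHARGED in the tree: `FundamentalGroup.riemannExistence_qbarDescent_of_finiteIndex_holds`.
[cite: SGA1, Exp. XII Thm. 5.1 and Exp. XIII Cor. 4.6] -/
theorem riemannExistenceQbarDescent_holds :
    Literature.AlgebraicGeometry.FundamentalGroup.riemannExistence_qbarDescent_of_finiteIndex :=
  Literature.AlgebraicGeometry.FundamentalGroup.riemannExistence_qbarDescent_of_finiteIndex_holds

/-- The route decl of stmt-16363 IS the named fact `deligne_globalInvariantCycles`: `Iff.rfl`. [folklore] -/
theorem deligneGlobalInvariantCycles_iff :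
    Summit.HodgeConjecture.HodgeConjecture.Theses.LinearSystemTorelli.DeligneGlobalInvariantCycles ↔
      deligne_globalInvariantCycles :=
  Iff.rfl

/-- **Transitivity of base change**: `(X_φ)_σ ≅ X_{σ ∘ φ}` (Mathlib `Over.pullbackComp`). [folklore] -/
theorem nonempty_iso_baseChangeHom_comp {k L M : Type} [CommRing k] [CommRing L] [CommRing M]
    (φ : k →+* L) (σ : L →+* M) (X : SchemeOver k) :
    Nonempty ((baseChangeHom σ).obj ((baseChangeHom φ).obj X) ≅ (baseChangeHom (σ.comp φ)).obj X) := by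
  have h : Spec.map (CommRingCat.ofHom (σ.comp φ)) =
      Spec.map (CommRingCat.ofHom σ) ≫ Spec.map (CommRingCat.ofHom φ) := by
    rw [CommRingCat.ofHom_comp, Spec.map_comp]
  refine ⟨((CategoryTheory.Over.pullbackComp (Spec.map (CommRingCat.ofHom σ))
      (Spec.map (CommRingCat.ofHom φ))).app X).symm ≪≫ CategoryTheory.eqToIso ?_⟩
  change (CategoryTheory.Over.pullback _).obj X = (CategoryTheory.Over.pullback _).obj X
  rw [h]

/-! ### Composition: the stubs conclude the crux BY NAME -/

/-- **Assembly, implication form** (kernel-checked, no `sorry`): K → J1 → J2 → D → `Envelope`.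
Fix `σ : ℚ̄ →+* ℂ`; spread `X` out over `ℚ̄` (`e : X ≅ 𝒳_s`, `s` `ℚ̄`-generic — PROVED); by Baire
(J1: the Hodge-rank jump locus is meagre; J2: the `Aut(ℂ/ℚ̄)`-orbit of `s` is comeagre) some conjugate
`τ · s` has generic Hodge rank; the fibre over `τ · s` is the `τ`-conjugate of `𝒳_s` (landed
p155949), so by K the Hodge rank of `𝒳_s` is generic too, and J1 gives type stability of the
transported class along ALL loops at `s`; hence FINITE monodromy orbit (Hodge–Riemann + lattice
finiteness, PROVED); Voisin's mechanism B (`Theorems.stub_dominantEnvelopeOfFiniteMonodromy`, PROVED)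
fed with Riemann existence (C, DISCHARGED `…_holds` 2026-08-17) and D (partie fixe) writes it as `ι^* c'` on a smooth projective
`W₀ ⊗_σ ℂ`; `W₀` is smooth projective over `ℚ̄` (`isSmoothProjective_of_baseChangeHom`, PROVED) and has
a number-field model (N = `Theorems.stub_numberFieldModel`, LANDED p145483). [folklore] -/
theorem Envelope_of :
    (∀ (σ : AlgebraicClosure ℚ →+* ℂ) (τ : ringAutOver σ) ⦃n : ℕ⦄ ⦃X Y : SchemeOver ℂ⦄,
      IsSmoothProjective n X →
      Nonempty (Y ≅ conjugateVariety
        (@AlgEquiv.toRingEquiv (AlgebraicClosure ℚ) ℂ ℂ _ _ _ σ.toAlgebra σ.toAlgebra τ) X) →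
      ∀ p : ℕ,
        Module.finrank ℚ ↥(Submodule.span ℚ {c : RestrictScalars ℚ ℂ (complexBetti Y (2 * p)) |
            IsRationalClass (show complexBetti Y (2 * p) from c) ∧
              IsOfHodgeType n Y (2 * p) p p (show complexBetti Y (2 * p) from c)}) =
        Module.finrank ℚ ↥(Submodule.span ℚ {c : RestrictScalars ℚ ℂ (complexBetti X (2 * p)) |
            IsRationalClass (show complexBetti X (2 * p) from c) ∧
              IsOfHodgeType n X (2 * p) p p (show complexBetti X (2 * p) from c)})) →
    (∀ (σ : AlgebraicClosure ℚ →+* ℂ) ⦃𝒳₀ S₀ : SchemeOver (AlgebraicClosure ℚ)⦄ (f₀ : 𝒳₀ ⟶ S₀)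
      (n p : ℕ), IsQuasiProjectiveOver 𝒳₀ → IsQuasiProjectiveOver S₀ → IrreducibleSpace S₀.left →
      AlgebraicGeometry.Smooth S₀.hom → IsSmoothProjectiveFamily ((baseChangeHom σ).map f₀) n →
      ∃ g : ℕ,
        IsMeagre {t : ComplexPoints ((baseChangeHom σ).obj S₀) |
          Module.finrank ℚ ↥(Submodule.span ℚ {c : RestrictScalars ℚ ℂ
              (complexBetti (fiberOver ((baseChangeHom σ).map f₀) t) (2 * p)) |
            IsRationalClass (show complexBetti (fiberOver ((baseChangeHom σ).map f₀) t) (2 * p) from c) ∧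
              IsOfHodgeType n (fiberOver ((baseChangeHom σ).map f₀) t) (2 * p) p p
                (show complexBetti (fiberOver ((baseChangeHom σ).map f₀) t) (2 * p) from c)}) ≠ g} ∧
        ∀ (t : ComplexPoints ((baseChangeHom σ).obj S₀)),
          Module.finrank ℚ ↥(Submodule.span ℚ {c : RestrictScalars ℚ ℂ
              (complexBetti (fiberOver ((baseChangeHom σ).map f₀) t) (2 * p)) |
            IsRationalClass (show complexBetti (fiberOver ((baseChangeHom σ).map f₀) t) (2 * p) from c) ∧
              IsOfHodgeType n (fiberOver ((baseChangeHom σ).map f₀) t) (2 * p) p p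
                (show complexBetti (fiberOver ((baseChangeHom σ).map f₀) t) (2 * p) from c)}) = g →
          ∀ (α : complexBetti (fiberOver ((baseChangeHom σ).map f₀) t) (2 * p)),
            IsRationalClass α → IsOfHodgeType n (fiberOver ((baseChangeHom σ).map f₀) t) (2 * p) p p α →
            ∀ (γ : Path t t) (β : complexBetti (fiberOver ((baseChangeHom σ).map f₀) t) (2 * p)),
              IsContinuationAlong γ α β →
                IsOfHodgeType n (fiberOver ((baseChangeHom σ).map f₀) t) (2 * p) p p β) →
    (∀ (σ : AlgebraicClosure ℚ →+* ℂ) (S₀ : SchemeOver (AlgebraicClosure ℚ)),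
      IsQuasiProjectiveOver S₀ → IrreducibleSpace S₀.left → AlgebraicGeometry.Smooth S₀.hom →
      ∀ (s : ComplexPoints ((baseChangeHom σ).obj S₀)),
        closure {(baseChangeHomFst σ S₀).base s.pt} = (Set.univ : Set S₀.left) →
        IsMeagre (Set.range fun τ : ringAutOver σ ↦ conjPoint σ S₀ τ s)ᶜ) →
    Summit.HodgeConjecture.HodgeConjecture.Theses.LinearSystemTorelli.DeligneGlobalInvariantCycles →
    Summit.HodgeConjecture.HodgeConjecture.Theses.QbarEnvelope.Envelope := by
  intro hK hJ1 hJ2 hD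
  unfold Summit.HodgeConjecture.HodgeConjecture.Theses.QbarEnvelope.Envelope
  intro n X hX p c hc hh
  -- an embedding `σ : ℚ̄ →+* ℂ`
  obtain ⟨σ⟩ := exists_ringHom_algebraicClosure_rat_complex
  -- spread `X` out over `ℚ̄`: `e : X ≅ 𝒳_s`, `s` over the generic point of the smooth irreducible `S₀`
  obtain ⟨𝒳₀, S₀, f₀, s, h𝒳₀, hS₀, hirr, hsm, hf, hgen, ⟨e⟩⟩ :=
    spreadingOut_smoothProjective_qbarFamily_holds σ hX
  -- finite monodromy orbit of the transported class `(e⁻¹)^* c` (type stability from K, J1, J2,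
  -- then Hodge–Riemann + lattice finiteness — unconditional in the tree)
  have hfin := Theorems.linearSystemTorelli_finite_setOf_isContinuationAlong_of_forall_isOfHodgeType σ
    f₀ n p hf h𝒳₀ hS₀ hirr hsm s (complexBetti.map e.inv (2 * p) c) (hc.map _)
    (typeStabilityAtQbarGeneric_of_hodgeRank hK hJ1 hJ2 σ f₀ n p h𝒳₀ hS₀ hirr hsm hf s hgen
      (complexBetti.map e.inv (2 * p) c) (hc.map _) (hh.map_of_iso e.symm))
  -- Voisin's mechanism B (PROVED), fed with Riemann existence (DISCHARGED in the tree) and D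
  obtain ⟨m, W₀, ι, c', hW, -, hc', hh', hmap⟩ :=
    Theorems.stub_dominantEnvelopeOfFiniteMonodromy
      riemannExistenceQbarDescent_holds
      (deligneGlobalInvariantCycles_iff.1 hD) σ f₀ n p h𝒳₀ hS₀ hirr hsm hf s hgen
      (complexBetti.map e.inv (2 * p) c) (hc.map _) (hh.map_of_iso e.symm) hfin
  -- `W₀` is smooth projective over `ℚ̄` (descent), so it has a number-field model (N, LANDED)
  obtain ⟨K, hK₀, hKn, ι₀, W₁, ⟨e₁⟩⟩ :=
    Theorems.stub_numberFieldModel W₀ (isSmoothProjective_of_baseChangeHom σ W₀ hW)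
  obtain ⟨e₂⟩ := nonempty_iso_baseChangeHom_comp ι₀ σ W₁
  refine ⟨m, (baseChangeHom σ).obj W₀, e.hom ≫ ι, c', hW,
    ⟨K, hK₀, hKn, σ.comp ι₀, W₁, ⟨(baseChangeHom σ).mapIso e₁ ≪≫ e₂⟩⟩, hc', hh', ?_⟩
  rw [complexBetti.map_comp, ModuleCat.comp_apply, hmap]
  exact e.complexBetti_map_hom_map_inv (2 * p) c

/-- **The crux from its registered stubs, by name** (no `sorry` of its own; conditional on the four
`stub_*` placeholders until they are proved — Riemann existence (C) and the number-field descent (N)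
are theorems of the tree). [folklore] -/
theorem Envelope_of_stubs : Summit.HodgeConjecture.HodgeConjecture.Theses.QbarEnvelope.Envelope :=
  Envelope_of stub_hodgeRank_conjugateVariety stub_typeStability_of_hodgeRank_eq_generic
    stub_isMeagre_compl_orbit_of_qbarGeneric stub_deligneGlobalInvariantCycles

end Summit.HodgeConjecture.HodgeConjecture.Cruxes.Envelope.HodgeRankConjugation
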